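import Summits.AtomisticToContinuum.HydrodynamicLimit.Theorems.JParityClosureEvenStressEnskogOneBodyDeviationRung0Helpers
import HarnessLib

/-!
# Velocity equilibration at rung 0 (stub S3b3 `stub_velocityEquilibrationRung0_of_deviation` of the
# line `preshock-kinetic-slaving`, crux `JParityClosure.EvenStressEnskog`, stmt-AtomisticToContinuum-13079)
# — helper file 2: the space integral of the `L¹` window deviation

For a family of probability measures `μ_N` on the `(N + 1)`-particle configurations, a continuous
test function `F(v, u, θ)` of quadratic growth `|F| ≤ C (1 + ‖v‖² + ‖u‖² + |θ|)`, the cone scale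
`r > 0` and the window deviation of `JParityClosureEvenStressEnskogOneBodyDeviationRung0Helpers.lean`,

  `D_N(w, x) = ∫ b_r(y, x) F(v, u_r, θ_r) dμ_w(y, v) − ρ_r(w, x) ∫ F(v, u_r, θ_r) M_{1,θ_r,u_r}(v) dv`,

we prove (`exists_lintegral_lintegral_windowDeviation_le`): IF the velocity second moments are
bounded, `∫⁻ (N+1)⁻¹ Σᵢ ‖vᵢ‖² dμ_N ≤ K`, and the deviation is `L¹(μ_N)`-small at EVERY centre,
`∫⁻ |D_N(·, x)| dμ_N ≤ ε` for `N ≥ N₀(x, ε)`, THEN it is small in `L¹(μ_N ⊗ dx)`: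
`∫⁻_w ∫⁻_x |D_N(w, x)| ≤ ε` for `N ≥ N₀(ε)`.  Proof: Tonelli (`lintegral_lintegral_swap`, joint Borel
measurability `measurable_windowDeviation_prod`) and dominated convergence on the compact torus
(`tendsto_lintegral_of_dominated_convergence`) with the constant majorant
`∫⁻ |D_N(·, x)| dμ_N ≤ 2C (3/πr³) + 6C (3/πr³) K` from the deterministic envelope
`abs_windowDeviation_le_velAvg` (`lintegral_abs_windowDeviation_le`).

References: H. Spohn, *Large Scale Dynamics of Interacting Particles* (1991), Part I §2.3.
-/

noncomputable section

open MeasureTheory Filter Set Topology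
open scoped ENNReal InnerProductSpace BigOperators

namespace Summit.AtomisticToContinuum.HydrodynamicLimit.Theorems.EvenStressEnskog

open Literature.Analysis.FluidPDE Literature.MathematicalPhysics.KineticTheory

variable {N : ℕ}

/-! ## Joint measurability of the window deviation -/

/-- **The window deviation `D(w, x)` is jointly Borel in `(w, x)`** (finite empirical sum of measurable
pieces; the Maxwellian pairing is Borel in its parameters, `measurable_integral_mul_localMaxwellian`).
[folklore] -/
theorem measurable_windowDeviation_prod (r : ℝ) {F : V3 × V3 × ℝ → ℝ} (hF : Continuous F) :
    Measurable fun q : Config (N + 1) (Fin 3) T3 × T3 =>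
      (∫ p, coneKernel r p.1 q.2 *
          F (p.2, KineticEntropyBalance.uC r q.1 q.2, mollTemperature r q.1 q.2) ∂(empiricalMeasure q.1)) -
        mollDensity r q.1 q.2 *
          ∫ v, F (v, KineticEntropyBalance.uC r q.1 q.2, mollTemperature r q.1 q.2) *
            localMaxwellian 1 (mollTemperature r q.1 q.2) (KineticEntropyBalance.uC r q.1 q.2) v := by
  have hf : Measurable fun q : Config (N + 1) (Fin 3) T3 × T3 => q.1 := measurable_fst
  have hρ := measurable_mollDensity_comp r hf measurable_snd
  have hu := measurable_uC_comp r hf measurable_snd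
  have hθ := measurable_mollTemperature_comp r hf measurable_snd
  have hS : Measurable fun q : Config (N + 1) (Fin 3) T3 × T3 =>
      ∫ p, coneKernel r p.1 q.2 *
        F (p.2, KineticEntropyBalance.uC r q.1 q.2, mollTemperature r q.1 q.2) ∂(empiricalMeasure q.1) := by
    have h : (fun q : Config (N + 1) (Fin 3) T3 × T3 =>
        ∫ p, coneKernel r p.1 q.2 *
          F (p.2, KineticEntropyBalance.uC r q.1 q.2, mollTemperature r q.1 q.2) ∂(empiricalMeasure q.1)) =
        fun q => ((N + 1 : ℕ) : ℝ)⁻¹ * ∑ i, coneKernel r (q.1 i).1 q.2 *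
          F ((q.1 i).2, KineticEntropyBalance.uC r q.1 q.2, mollTemperature r q.1 q.2) := by
      funext q
      rw [integral_empiricalMeasure]
    rw [h]
    refine measurable_const.mul (Finset.measurable_sum _ fun i _ => ?_)
    exact (measurable_coneKernel_comp r ((measurable_pi_apply i).comp hf).fst measurable_snd).mul
      (hF.measurable.comp (((measurable_pi_apply i).comp hf).snd.prodMk (hu.prodMk hθ)))
  exact hS.sub (hρ.mul ((measurable_integral_mul_localMaxwellian hF).comp (hu.prodMk hθ)))

/-- `x ↦ ∫⁻ |D(w, x)| dμ(w)` is Borel on the torus (Tonelli measurability). [folklore] -/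
theorem measurable_lintegral_abs_windowDeviation (r : ℝ) {F : V3 × V3 × ℝ → ℝ} (hF : Continuous F)
    (μ : Measure (Config (N + 1) (Fin 3) T3)) [SFinite μ] :
    Measurable fun x : T3 => ∫⁻ w, ENNReal.ofReal
      |(∫ p, coneKernel r p.1 x *
            F (p.2, KineticEntropyBalance.uC r w x, mollTemperature r w x) ∂(empiricalMeasure w)) -
        mollDensity r w x *
          ∫ v, F (v, KineticEntropyBalance.uC r w x, mollTemperature r w x) *
            localMaxwellian 1 (mollTemperature r w x) (KineticEntropyBalance.uC r w x) v| ∂μ :=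
  (measurable_windowDeviation_prod r hF).abs.ennreal_ofReal.lintegral_prod_left'

/-! ## The constant majorant -/

/-- The velocity average `(N+1)⁻¹ Σᵢ ‖vᵢ‖²` is nonnegative. [folklore] -/
theorem velAvg_nonneg (w : Config (N + 1) (Fin 3) T3) :
    0 ≤ ((N + 1 : ℕ) : ℝ)⁻¹ * ∑ i, ‖(w i).2‖ ^ 2 :=
  mul_nonneg (inv_nonneg.2 (Nat.cast_nonneg _)) (Finset.sum_nonneg fun _ _ => sq_nonneg _)

/-- **Majorant of the `L¹` deviation at a centre** under a probability measure:
`∫⁻ |D(·, x)| dμ ≤ ofReal (2C (3/πr³)) + ofReal (6C (3/πr³)) · ∫⁻ (N+1)⁻¹ Σᵢ ‖vᵢ‖² dμ`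
(the deterministic envelope `abs_windowDeviation_le_velAvg` integrated). [folklore] -/
theorem lintegral_abs_windowDeviation_le {r : ℝ} (hr : 0 < r) {F : V3 × V3 × ℝ → ℝ} {C : ℝ}
    (hC : ∀ q, |F q| ≤ C * (1 + ‖q.1‖ ^ 2 + ‖q.2.1‖ ^ 2 + |q.2.2|))
    (μ : Measure (Config (N + 1) (Fin 3) T3)) [IsProbabilityMeasure μ] (x : T3) :
    ∫⁻ w, ENNReal.ofReal
        |(∫ p, coneKernel r p.1 x *
              F (p.2, KineticEntropyBalance.uC r w x, mollTemperature r w x) ∂(empiricalMeasure w)) -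
          mollDensity r w x *
            ∫ v, F (v, KineticEntropyBalance.uC r w x, mollTemperature r w x) *
              localMaxwellian 1 (mollTemperature r w x) (KineticEntropyBalance.uC r w x) v| ∂μ ≤
      ENNReal.ofReal (2 * C * (3 / (Real.pi * r ^ 3))) +
        ENNReal.ofReal (6 * C * (3 / (Real.pi * r ^ 3))) *
          ∫⁻ w, ENNReal.ofReal (((N + 1 : ℕ) : ℝ)⁻¹ * ∑ i, ‖(w i).2‖ ^ 2) ∂μ := by
  have hC0 : 0 ≤ C := quadGrowthConst_nonneg hC
  have hB : 0 ≤ 3 / (Real.pi * r ^ 3) := by positivity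
  have h1 : 0 ≤ 2 * C * (3 / (Real.pi * r ^ 3)) := by positivity
  have h2 : 0 ≤ 6 * C * (3 / (Real.pi * r ^ 3)) := by positivity
  calc ∫⁻ w, ENNReal.ofReal
        |(∫ p, coneKernel r p.1 x *
              F (p.2, KineticEntropyBalance.uC r w x, mollTemperature r w x) ∂(empiricalMeasure w)) -
          mollDensity r w x *
            ∫ v, F (v, KineticEntropyBalance.uC r w x, mollTemperature r w x) *
              localMaxwellian 1 (mollTemperature r w x) (KineticEntropyBalance.uC r w x) v| ∂μ
      ≤ ∫⁻ w, (ENNReal.ofReal (2 * C * (3 / (Real.pi * r ^ 3))) +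
          ENNReal.ofReal (6 * C * (3 / (Real.pi * r ^ 3))) *
            ENNReal.ofReal (((N + 1 : ℕ) : ℝ)⁻¹ * ∑ i, ‖(w i).2‖ ^ 2)) ∂μ := by
        refine lintegral_mono fun w => ?_
        rw [← ENNReal.ofReal_mul h2, ← ENNReal.ofReal_add h1 (mul_nonneg h2 (velAvg_nonneg w))]
        exact ENNReal.ofReal_le_ofReal (abs_windowDeviation_le_velAvg hr hC w x)
    _ = ENNReal.ofReal (2 * C * (3 / (Real.pi * r ^ 3))) +
        ENNReal.ofReal (6 * C * (3 / (Real.pi * r ^ 3))) *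
          ∫⁻ w, ENNReal.ofReal (((N + 1 : ℕ) : ℝ)⁻¹ * ∑ i, ‖(w i).2‖ ^ 2) ∂μ := by
        rw [lintegral_add_left measurable_const, lintegral_const, measure_univ, mul_one,
          lintegral_const_mul' _ _ ENNReal.ofReal_ne_top]

/-! ## The space integral: the registered sub-goal -/

/-- **Space integral of the `L¹` window deviation** (sub-goal of
`stub_velocityEquilibrationRung0_of_deviation`, line `preshock-kinetic-slaving`): for probability
measures `μ_N` on the `(N+1)`-particle configurations with bounded velocity second moments
`∫⁻ (N+1)⁻¹ Σᵢ ‖vᵢ‖² dμ_N ≤ K`, a continuous quadratic-growth `F` and `r > 0`, the pointwise-in-`x`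
`L¹` smallness `∫⁻ |D_N(·, x)| dμ_N ≤ ε (N ≥ N₀(x, ε))` upgrades to
`∫⁻_w ∫⁻_x |D_N(w, x)| dx dμ_N ≤ ε (N ≥ N₀(ε))` — Tonelli and dominated convergence on the torus with
the constant majorant `lintegral_abs_windowDeviation_le`. [folklore] -/
theorem exists_lintegral_lintegral_windowDeviation_le :
    ∀ {r : ℝ}, 0 < r → ∀ {F : V3 × V3 × ℝ → ℝ}, Continuous F → ∀ {C : ℝ},
    (∀ q, |F q| ≤ C * (1 + ‖q.1‖ ^ 2 + ‖q.2.1‖ ^ 2 + |q.2.2|)) →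
    ∀ (μ : (N : ℕ) → Measure (Config (N + 1) (Fin 3) T3)), (∀ N, IsProbabilityMeasure (μ N)) →
    ∀ {K : ℝ}, (∀ N : ℕ, ∫⁻ w, ENNReal.ofReal (((N + 1 : ℕ) : ℝ)⁻¹ * ∑ i, ‖(w i).2‖ ^ 2) ∂(μ N) ≤
      ENNReal.ofReal K) →
    (∀ x : T3, ∀ ε : ℝ, 0 < ε → ∃ N₀ : ℕ, ∀ N : ℕ, N₀ ≤ N →
      ∫⁻ w, ENNReal.ofReal
          |(∫ q, coneKernel r q.1 x *
                F (q.2, KineticEntropyBalance.uC r w x, mollTemperature r w x) ∂(empiricalMeasure w)) -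
            mollDensity r w x *
              ∫ v, F (v, KineticEntropyBalance.uC r w x, mollTemperature r w x) *
                localMaxwellian 1 (mollTemperature r w x) (KineticEntropyBalance.uC r w x) v|
        ∂(μ N) ≤ ENNReal.ofReal ε) →
    ∀ ε : ℝ, 0 < ε → ∃ N₀ : ℕ, ∀ N : ℕ, N₀ ≤ N →
      ∫⁻ w, (∫⁻ x : T3, ENNReal.ofReal
          |(∫ q, coneKernel r q.1 x *
                F (q.2, KineticEntropyBalance.uC r w x, mollTemperature r w x) ∂(empiricalMeasure w)) -
            mollDensity r w x *
              ∫ v, F (v, KineticEntropyBalance.uC r w x, mollTemperature r w x) *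
                localMaxwellian 1 (mollTemperature r w x) (KineticEntropyBalance.uC r w x) v|)
        ∂(μ N) ≤ ENNReal.ofReal ε := by
  intro r hr F hF C hC μ hprob K hK hpt ε hε
  -- the pointwise `L¹` norms `q_N(x)`
  set q : ℕ → T3 → ℝ≥0∞ := fun N x => ∫⁻ w, ENNReal.ofReal
      |(∫ p, coneKernel r p.1 x *
            F (p.2, KineticEntropyBalance.uC r w x, mollTemperature r w x) ∂(empiricalMeasure w)) -
        mollDensity r w x *
          ∫ v, F (v, KineticEntropyBalance.uC r w x, mollTemperature r w x) *
            localMaxwellian 1 (mollTemperature r w x) (KineticEntropyBalance.uC r w x) v| ∂(μ N)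
    with hq
  have hqm : ∀ N, Measurable (q N) := fun N => measurable_lintegral_abs_windowDeviation r hF (μ N)
  -- Tonelli
  have hswap : ∀ N, ∫⁻ w, (∫⁻ x : T3, ENNReal.ofReal
      |(∫ p, coneKernel r p.1 x *
            F (p.2, KineticEntropyBalance.uC r w x, mollTemperature r w x) ∂(empiricalMeasure w)) -
        mollDensity r w x *
          ∫ v, F (v, KineticEntropyBalance.uC r w x, mollTemperature r w x) *
            localMaxwellian 1 (mollTemperature r w x) (KineticEntropyBalance.uC r w x) v|) ∂(μ N) =
      ∫⁻ x, q N x := fun N =>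
    lintegral_lintegral_swap (measurable_windowDeviation_prod r hF).abs.ennreal_ofReal.aemeasurable
  -- the constant majorant
  set B : ℝ≥0∞ := ENNReal.ofReal (2 * C * (3 / (Real.pi * r ^ 3))) +
    ENNReal.ofReal (6 * C * (3 / (Real.pi * r ^ 3))) * ENNReal.ofReal K with hB
  have hBtop : B ≠ ∞ := ENNReal.add_ne_top.2
    ⟨ENNReal.ofReal_ne_top, ENNReal.mul_ne_top ENNReal.ofReal_ne_top ENNReal.ofReal_ne_top⟩
  have hqB : ∀ N x, q N x ≤ B := fun N x => by
    haveI := hprob N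
    refine (lintegral_abs_windowDeviation_le hr hC (μ N) x).trans ?_
    rw [hB]
    gcongr
    exact hK N
  -- pointwise convergence
  have hlim : ∀ x, Tendsto (fun N => q N x) atTop (𝓝 0) := fun x => by
    rw [ENNReal.tendsto_atTop_zero]
    intro e he
    rcases eq_or_ne e ∞ with htop | htop
    · exact ⟨0, fun n _ => htop ▸ le_top⟩
    · obtain ⟨N₀, hN₀⟩ := hpt x e.toReal (ENNReal.toReal_pos he.ne' htop)
      exact ⟨N₀, fun n hn => (hN₀ n hn).trans (ENNReal.ofReal_toReal htop).le⟩
  -- dominated convergence on the torus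
  have hT : Tendsto (fun N => ∫⁻ x, q N x) atTop (𝓝 (∫⁻ _ : T3, (0 : ℝ≥0∞))) :=
    tendsto_lintegral_of_dominated_convergence (fun _ => B) hqm
      (fun N => ae_of_all _ (hqB N)) (by rw [lintegral_const, measure_univ, mul_one]; exact hBtop)
      (ae_of_all _ hlim)
  rw [lintegral_zero] at hT
  obtain ⟨N₀, hN₀⟩ := ENNReal.tendsto_atTop_zero.1 hT (ENNReal.ofReal ε) (ENNReal.ofReal_pos.2 hε)
  exact ⟨N₀, fun N hN => (hswap N).trans_le (hN₀ N hN)⟩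

end Summit.AtomisticToContinuum.HydrodynamicLimit.Theorems.EvenStressEnskog

end
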